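import Summits.Ventures.LatticeQCDFlow.Scaling.WarmStartCeiling
import Summits.Ventures.LatticeQCDFlow.Scaling.DominatedStarDoeblin

/-!
HONEST FRAMING: exact (Metropolis-corrected) sampling algorithms for lattice gauge theory; figures
of merit are autocorrelation/cost numbers at stated couplings and volumes; no continuum-physics
claim.

# WarmStartApproximate — A WARM START THAT IS ONLY CLOSE TO THE PINNED ONE: FOR ANY INITIAL PROBABILITY VECTOR `λ` OVER
# CONFIGURATIONS, `‖λPⁿ − π̃‖_TV ≤ (1 − tcp/(2m))ⁿ·[((2K+p)/p)·‖λ − λ₀‖_TV + (2#(D₀∖0) + p𝟙{0∈D₀})/p]` WHERE `λ₀` PINS THE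
# REPLICAS OF `D₀` AND DRAWS THE REST EXACTLY — THE `log K` OF THE COLD START IS PAID ONLY ON THE DISCREPANCY
# `‖λ − λ₀‖_TV` (lean-2 GEN-26, ours)

Venture-side (OURS).  Cell `lqcd-flow` (pub-lqcd), unit `pub-lqcd-lean-2-g26`, 2026-08-27.  Chapter M, file 29 — the
triangle between `Scaling/DominatedStarDoeblin` (any two initial laws merge at rate `ρ = 1 − tcp/(2m)` with the
Dobrushin constant `(2K+p)/p`) and `Scaling/WarmStartCeiling` (the pinned start mixes with constant
`(2#(D₀∖0) + p𝟙{0∈D₀})/p`).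

## What is proved

* **`approxWarmStart_tvDist_le`** — one-sided domination `p`, `4t ≤ p(1−t)w_0`, exact hot sampler, reversible cold
  kernels, hub multiplicities `≥ c ≥ 1`, any initial law `λ` of unit mass, the pinned product start `λ₀ = tensorFun g` on `D₀`:
  **`‖λPⁿ − π̃‖_TV ≤ ((2K+p)/p)(1 − tcp/(2m))ⁿ·‖λ − λ₀‖_TV + ((2#(D₀∖0) + p𝟙{0∈D₀})/p)(1 − tcp/(2m))ⁿ`**.

Reading (no numerics implied): restarting `j` replicas of an equilibrated ladder from replicas that are merely
APPROXIMATELY right costs `(2m/(tcp))·log` of `(2j+p)/p + ((2K+p)/p)·‖λ − λ₀‖_TV` over `ε` — the full `log K` returns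
only in proportion to how far the actual start is from "pinned on `D₀`, exact elsewhere".  NOT CLAIMED: a bound in
terms of per-replica discrepancies (the product structure of `‖λ − λ₀‖` is not unfolded); anything measured.
Literature grade (cell rule): OWN COMPOSITION; nothing cited as a fact; no new bib keys.
-/

noncomputable section

open Finset Function
open Literature.Probability.MarkovChains

namespace Summit.Ventures.LatticeQCDFlow.Scaling

variable {S : Type*} [Fintype S] [DecidableEq S] {K m : ℕ} {μ : Fin (K + 1) → S → ℝ} {M : Fin (K + 1) → S → S → ℝ}
  {w : Fin (K + 1) → ℝ} {t p : ℝ}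

section Approx
variable (κ : Fin m → Fin K) (φ : Fin m → Equiv.Perm S)

/-- **THE APPROXIMATE WARM START:** for every probability vector `λ` over configurations,
`‖λPⁿ − π̃‖_TV ≤ ((2K+p)/p)ρⁿ·‖λ − λ₀‖_TV + ((2#(D₀∖0) + p𝟙{0∈D₀})/p)ρⁿ`, `ρ = 1 − tcp/(2m)`, `λ₀` the pinned product
start on `D₀`. [ours] -/
theorem approxWarmStart_tvDist_le (hm : 1 ≤ m) (ht0 : 0 ≤ t) (ht1 : t ≤ 1) (hw0 : ∀ k, 0 ≤ w k) (hw1 : ∑ k, w k = 1)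
    (hμ : ∀ k x, 0 < μ k x) (hμ1 : ∀ k, ∑ u, μ k u = 1) (hM : ∀ k, IsRowStochastic (M k))
    (hMrev : ∀ k, DetailedBalance (μ k) (M k)) (hM0 : ∀ u v, M 0 u v = μ 0 v) (hp0 : 0 < p) (hp1 : p ≤ 1)
    (hdom : ∀ r u, p * μ (κ r).succ (φ r u) ≤ μ 0 u) (hreg : 4 * t ≤ p * (1 - t) * w 0)
    {c : ℕ} (hc1 : 1 ≤ c) (hc : ∀ p' : Fin K, c ≤ (univ.filter (fun r : Fin m => κ r = p')).card) (hcm : c ≤ m)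
    (D₀ : Finset (Fin (K + 1))) (x : Fin (K + 1) → S)
    {g : Fin (K + 1) → S → ℝ} (hg' : ∀ j u, g j u = if j ∈ D₀ then (if u = x j then (1 : ℝ) else 0) else μ j u)
    {lam : (Fin (K + 1) → S) → ℝ} (hlam1 : ∑ z, lam z = 1) (n : ℕ) :
    tvDist (lawAt (fun y z : Fin (K + 1) → S =>
          t * ptGraphSwap μ (fun r : Fin m => (((0 : Fin (K + 1)), (κ r).succ) : Fin (K + 1) × Fin (K + 1))) φ y z
          + (1 - t) * prodKernel w M y z) lam n) (tensorFun μ)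
      ≤ (2 * (K : ℝ) + p) / p * (1 - t * c * p / (2 * m)) ^ n * tvDist lam (tensorFun g)
        + (2 * ((D₀.erase 0).card : ℝ) + p * (if (0 : Fin (K + 1)) ∈ D₀ then (1 : ℝ) else 0)) / p
          * (1 - t * c * p / (2 * m)) ^ n := by
  have hstat : ∀ k : Fin (K + 1), k ≠ 0 → ∀ v, ∑ u, μ k u * M k u v = μ k v :=
    fun k _ v => (hMrev k).isStationary (hM k).2 v
  have hg1 : ∑ z, tensorFun g z = 1 := sum_tensorFun_eq_one g (pinnedLaw_mass_one hμ1 D₀ x hg')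
  have hmerge := dominatedStar_merge κ φ hm ht0 ht1 hw0 hw1 hμ hμ1 hM hM0 hstat hp0 hp1 hdom hreg hc1 hc hcm
    (μ₀ := lam) (ν₀ := tensorFun g) (by rw [hlam1, hg1]) n
  have hwarm := warmStart_tvDist_le κ φ hm ht0 ht1 hw0 hw1 hμ hμ1 hM hM0 hstat hp0 hp1 hdom hreg hc1 hc hcm D₀ x hg' n
  have htri := tvDist_triangle
    (lawAt (fun y z : Fin (K + 1) → S =>
      t * ptGraphSwap μ (fun r : Fin m => (((0 : Fin (K + 1)), (κ r).succ) : Fin (K + 1) × Fin (K + 1))) φ y z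
        + (1 - t) * prodKernel w M y z) lam n)
    (lawAt (fun y z : Fin (K + 1) → S =>
      t * ptGraphSwap μ (fun r : Fin m => (((0 : Fin (K + 1)), (κ r).succ) : Fin (K + 1) × Fin (K + 1))) φ y z
        + (1 - t) * prodKernel w M y z) (tensorFun g) n)
    (tensorFun μ)
  linarith

end Approx

end Summit.Ventures.LatticeQCDFlow.Scaling

end
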